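import Literature.Geometry.Kaehler.RiemannSurfaceGenusOnePeriods
import Literature.Geometry.Kaehler.RiemannSurfaceMeromorphicOneFormSpaces
import Mathlib.Analysis.Complex.OpenMapping
import HarnessLib

/-!
# At most one holomorphic 1-form on a Riemann surface homeomorphic to a torus
# (the period bound `dim_ℂ H⁰(T, Ω¹) ≤ 1`, Farkas–Kra III.2.7 / III.6.4)

Layer `Literature/Geometry/Kaehler`, PROOF-ONLY sequel (no definitions) of
`RiemannSurfaceOneFormDevelopment` and `RiemannSurfaceGenusOnePeriods` (abc-iut-L4-t12: developments
`F` of a holomorphic `1`-form `ω` along the universal covering `q = e₀⁻¹ ∘ cover Φ₀ : ℂ → T` of a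
Riemann surface `T` with a HOMEOMORPHISM `e₀ : T ≃ₜ ComplexTorus Φ₀`; periods
`F (z + Φ₀ n) = F z + P n`; the maximum-principle step `eq_zero_of_forall_period` for forms WITHOUT
ZEROS).  H. M. Farkas, I. Kra, *Riemann Surfaces*, GTM 71 (1992), III.2.7 (if all periods of a
holomorphic differential are purely imaginary, `Re ∫ φ` is single-valued on the compact surface,
hence constant, so `φ = 0`) and III.6.4 (the torus).  Here the form may HAVE ZEROS, which is what the
dimension count needs:

`IsPrimitiveOn.add/.smul`, `IsDevelopment.add/.smul` (linearity in the form);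
`IsDevelopment.re_period_eq_zero` (purely imaginary basic periods ⇒ all periods purely imaginary);
**`IsDevelopment.eq_zero_of_isMax_re`** — if `Re F` attains a maximum then `ω = 0` (local primitive
at the maximiser, `q` open, open mapping theorem in a chart, identity theorem for `1`-forms);
**`IsDevelopment.eq_zero_of_forall_re_period_eq_zero`** — purely imaginary basic periods
`F(Φ₀ eᵢ) − F(0)` force `ω = 0`; **`exists_ne_zero_smul_add_smul_eq_zero`** — any two holomorphic
`1`-forms on `T` are `ℂ`-linearly dependent (real parts of basic periods: an `ℝ`-linear `ℂ² → ℝ²`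
has a kernel).  Sub-piece GAP-A4 of the abc-iut GAP G-L4t12g4-1 `GenusOneUniformization`
(classical base of [AbsTopIII] Cor. 2.7 (c)); nothing here bears on [IUTchIII] Cor. 3.12.
-/

noncomputable section

open scoped Manifold ContDiff Topology
open Set Filter Function Complex

namespace Literature.Geometry.Kaehler

namespace RiemannSurface

namespace MeromorphicOneForm

/-! ### Linearity of primitives and developments -/

section Linear

variable {M : Type*} [TopologicalSpace M] [ChartedSpace ℂ M]
variable {A : Type*} [TopologicalSpace A]
variable {η η₁ η₂ : MeromorphicOneForm M} {G G₁ G₂ : M → ℂ} {U : Set M} {q : A → M}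
  {F F₁ F₂ : A → ℂ}

/-- The sum of primitives is a primitive of the sum. [cite: Miranda1995, Chapter IV §4 Lemma 4.8] -/
theorem IsPrimitiveOn.add (h₁ : η₁.IsPrimitiveOn G₁ U) (h₂ : η₂.IsPrimitiveOn G₂ U) :
    (η₁ + η₂).IsPrimitiveOn (fun y ↦ G₁ y + G₂ y) U := by
  intro e he x hx hxe
  rw [localExpr_add']
  exact (h₁ he hx hxe).add (h₂ he hx hxe)

/-- A constant multiple of a primitive is a primitive of the multiple. [cite: Miranda1995, Chapter IV §4 Lemma 4.8] -/
theorem IsPrimitiveOn.smul (c : ℂ) (h : η.IsPrimitiveOn G U) :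
    (c • η).IsPrimitiveOn (fun y ↦ c * G y) U := by
  intro e he x hx hxe
  rw [localExpr_smul']
  exact (h he hx hxe).const_mul c

/-- The sum of developments is a development of the sum. [cite: FarkasKra1992, III.6.4] -/
theorem IsDevelopment.add (hF₁ : η₁.IsDevelopment q F₁) (hF₂ : η₂.IsDevelopment q F₂) :
    (η₁ + η₂).IsDevelopment q (fun b ↦ F₁ b + F₂ b) := by
  intro a
  obtain ⟨U₁, hU₁o, haU₁, G₁, hG₁, hFG₁⟩ := hF₁ a
  obtain ⟨U₂, hU₂o, haU₂, G₂, hG₂, hFG₂⟩ := hF₂ a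
  refine ⟨U₁ ∩ U₂, hU₁o.inter hU₂o, ⟨haU₁, haU₂⟩, fun y ↦ G₁ y + G₂ y,
    (hG₁.mono inter_subset_left).add (hG₂.mono inter_subset_right), ?_⟩
  filter_upwards [hFG₁, hFG₂] with b hb₁ hb₂
  simp only [hb₁, hb₂, comp_apply]

/-- A constant multiple of a development is a development of the multiple. [cite: FarkasKra1992, III.6.4] -/
theorem IsDevelopment.smul (c : ℂ) (hF : η.IsDevelopment q F) :
    (c • η).IsDevelopment q (fun b ↦ c * F b) := by
  intro a
  obtain ⟨U, hUo, haU, G, hG, hFG⟩ := hF a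
  refine ⟨U, hUo, haU, fun y ↦ c * G y, hG.smul c, ?_⟩
  filter_upwards [hFG] with b hb
  simp only [hb, comp_apply]

end Linear

/-! ### Developments along the universal covering of a topological torus -/

section Torus

open ComplexTorus

variable {T : Type*} [TopologicalSpace T] [ChartedSpace ℂ T]
variable {Φ₀ : (Fin 2 → ℝ) ≃L[ℝ] ℂ} {e₀ : T ≃ₜ ComplexTorus Φ₀}
variable {η : MeromorphicOneForm T} {F : ℂ → ℂ}

/-- If the two basic periods have zero real part, every period has zero real part (the period map is
a homomorphism `ℤ² → ℂ`, `IsDevelopment.period_add/period_zsmul`). [cite: FarkasKra1992, III.2.7] -/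
theorem IsDevelopment.re_period_eq_zero (hF : η.IsDevelopment (fun z ↦ e₀.symm (cover Φ₀ z)) F)
    (hre : ∀ i : Fin 2, (F (latticeVec Φ₀ (Pi.single i 1)) - F 0).re = 0)
    (n : Fin 2 → ℤ) : (F (latticeVec Φ₀ n) - F 0).re = 0 := by
  have hdecomp : n = n 0 • Pi.single 0 1 + n 1 • Pi.single 1 1 := by
    ext i; fin_cases i <;> simp
  rw [hdecomp, hF.period_add, hF.period_zsmul, hF.period_zsmul, add_re, Complex.smul_re,
    Complex.smul_re, hre 0, hre 1, smul_zero, smul_zero, add_zero]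

/-- A continuous lattice-periodic real function on `ℂ` attains its maximum (on the compact
fundamental parallelogram, `ComplexTorus.exists_mem_image_Icc_add_latticeVec`).
[cite: FarkasKra1992, III.2.7] -/
theorem exists_forall_le_of_latticePeriodic {g : ℂ → ℝ} (hg : Continuous g)
    (hper : ∀ z (n : Fin 2 → ℤ), g (z + latticeVec Φ₀ n) = g z) : ∃ z₀, ∀ z, g z ≤ g z₀ := by
  have hKc : IsCompact (Φ₀ '' Set.pi univ (fun _ ↦ Icc (0 : ℝ) 1)) :=
    (isCompact_univ_pi fun _ ↦ isCompact_Icc).image Φ₀.continuous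
  obtain ⟨z₀, -, hmax⟩ :=
    hKc.exists_isMaxOn ⟨Φ₀ 0, 0, fun i _ ↦ ⟨le_rfl, zero_le_one⟩, rfl⟩ hg.continuousOn
  refine ⟨z₀, fun z ↦ ?_⟩
  obtain ⟨k, hk, n, rfl⟩ := exists_mem_image_Icc_add_latticeVec (Φ := Φ₀) z
  rw [hper]
  exact hmax hk

variable [IsManifold 𝓘(ℂ, ℂ) ω T]

/-- **The maximum-principle step for forms with zeros** (Farkas–Kra III.2.7): if a development `F` of
the holomorphic form `ω` along the universal covering `q : ℂ → T` has `Re F` attaining a global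
maximum, then `ω = 0`.  At the maximiser `F = G ∘ q` with `G` a local primitive and `q` open, so in
the chart at `q z₀` the holomorphic `G ∘ z⁻¹` has a local maximum of its real part, hence is locally
constant (open mapping theorem); so `ω = dG` vanishes identically near a point, hence everywhere
(identity theorem for `1`-forms; `T` is connected, being homeomorphic to a torus).
[cite: FarkasKra1992, III.2.7] -/
theorem IsDevelopment.eq_zero_of_isMax_re (hF : η.IsDevelopment (fun z ↦ e₀.symm (cover Φ₀ z)) F)
    (hη : η.IsHolomorphic) {z₀ : ℂ} (hmax : ∀ z, (F z).re ≤ (F z₀).re) : η = 0 := by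
  set q : ℂ → T := fun z ↦ e₀.symm (cover Φ₀ z) with hq
  obtain ⟨U, hUo, hz₀U, G, hG, hFG⟩ := hF z₀
  set p₀ : T := q z₀ with hp₀
  -- `Re G` has a local maximum at `p₀` (`q` is open)
  have hGmax : ∀ᶠ p in 𝓝 p₀, (G p).re ≤ (G p₀).re := by
    obtain ⟨N, hN, hNsub⟩ : ∃ N ∈ 𝓝 z₀, ∀ z ∈ N, F z = G (q z) := eventually_iff_exists_mem.1 hFG
    have hz₀N : F z₀ = G p₀ := hNsub z₀ (mem_of_mem_nhds hN)
    filter_upwards [(isLocalHomeomorph_symm_comp_cover e₀).isOpenMap.image_mem_nhds hN] with p hp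
    obtain ⟨z, hzN, rfl⟩ := hp
    rw [← hNsub z hzN, ← hz₀N]
    exact hmax z
  -- in the chart `e` at `p₀`, `Gh = G ∘ e⁻¹` has derivative `η.localExpr e` on `W = e(U ∩ source)`
  set e := chartAt ℂ p₀ with he
  have hp₀e : p₀ ∈ e.source := mem_chart_source ℂ p₀
  set w₀ := e p₀ with hw₀
  set Gh : ℂ → ℂ := G ∘ e.symm with hGh
  set W : Set ℂ := e.target ∩ e.symm ⁻¹' U with hW
  have hWo : IsOpen W := e.isOpen_inter_preimage_symm hUo
  have hw₀W : w₀ ∈ W := ⟨e.map_source hp₀e, by show e.symm (e p₀) ∈ U; rwa [e.left_inv hp₀e]⟩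
  have hderiv : ∀ w ∈ W, HasDerivAt Gh (η.localExpr e w) w := by
    rintro w ⟨hwt, hwU⟩
    have h := hG (chart_mem_atlas ℂ p₀) hwU (e.map_target hwt)
    rwa [e.right_inv hwt] at h
  have han : AnalyticAt ℂ Gh w₀ :=
    DifferentiableOn.analyticAt (fun w hw ↦ (hderiv w hw).differentiableAt.differentiableWithinAt)
      (hWo.mem_nhds hw₀W)
  -- the local maximum of `Re Gh` at `w₀`
  have hGhmax : ∀ᶠ w in 𝓝 w₀, (Gh w).re ≤ (Gh w₀).re := by
    have h1 : ∀ᶠ w in 𝓝 w₀, (G (e.symm w)).re ≤ (G p₀).re :=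
      (e.continuousAt_symm (e.map_source hp₀e)).eventually (by rwa [e.left_inv hp₀e])
    rwa [show Gh w₀ = G p₀ by simp only [hGh, comp_apply, hw₀, e.left_inv hp₀e]]
  -- open mapping: `Gh` is locally constant near `w₀`
  have hconst : ∀ᶠ w in 𝓝 w₀, Gh w = Gh w₀ := by
    rcases han.eventually_constant_or_nhds_le_map_nhds with h | h
    · exact h
    · exfalso
      have hmem : Gh '' {w | (Gh w).re ≤ (Gh w₀).re} ∈ 𝓝 (Gh w₀) := h (image_mem_map hGhmax)
      obtain ⟨ε, hε, hball⟩ := Metric.mem_nhds_iff.1 hmem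
      have hin : Gh w₀ + (ε / 2 : ℝ) ∈ Metric.ball (Gh w₀) ε := by
        rw [Metric.mem_ball, dist_eq_norm, add_sub_cancel_left, Complex.norm_real, Real.norm_eq_abs,
          abs_of_pos (half_pos hε)]
        exact half_lt_self hε
      obtain ⟨w, hw, hweq⟩ := hball hin
      have : (Gh w).re = (Gh w₀).re + ε / 2 := by rw [hweq, add_re, ofReal_re]
      have hw' : (Gh w).re ≤ (Gh w₀).re := hw
      linarith
  -- hence `η.localExpr e = 0` near `w₀`
  have hzero : ∀ᶠ w in 𝓝 w₀, η.localExpr e w = 0 := by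
    have hd0 : ∀ᶠ w in 𝓝 w₀, HasDerivAt Gh 0 w := by
      filter_upwards [hconst.eventually_nhds] with w hw
      exact (hasDerivAt_const w (Gh w₀)).congr_of_eventuallyEq hw
    filter_upwards [hWo.mem_nhds hw₀W, hd0] with w hw hw0
    exact (hderiv w hw).unique hw0
  -- so `ω` vanishes identically near `p₀`, hence everywhere
  have htop : η.meromorphicOrderAt p₀ = ⊤ := by
    rw [meromorphicOrderAt_def, meromorphicOrderAt_eq_top_iff]
    exact hzero.filter_mono nhdsWithin_le_nhds
  haveI : ConnectedSpace T := e₀.connectedSpace_iff.2 inferInstance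
  ext p
  rw [coe_zero, Pi.zero_apply]
  exact (hη p).apply_eq_zero_of_meromorphicOrderAt_eq_top
    (η.meromorphicOrderAt_eq_top_of_preconnectedSpace htop p)

/-- **Purely imaginary periods force `ω = 0`** (Farkas–Kra III.2.7 on a torus; zeros of `ω`
allowed): for a Riemann surface `T` homeomorphic to a torus (`e₀ : T ≃ₜ ℂ/Φ₀(ℤ²)`, any complex
structure), a holomorphic `1`-form `ω` and a development `F` of `ω` along `e₀⁻¹ ∘ cover Φ₀ : ℂ → T`,
if the two basic periods `F(Φ₀ eᵢ) − F(0)` have zero real part then `ω = 0`.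
[cite: FarkasKra1992, III.2.7] -/
theorem IsDevelopment.eq_zero_of_forall_re_period_eq_zero
    (hF : η.IsDevelopment (fun z ↦ e₀.symm (cover Φ₀ z)) F) (hη : η.IsHolomorphic)
    (hre : ∀ i : Fin 2, (F (latticeVec Φ₀ (Pi.single i 1)) - F 0).re = 0) : η = 0 := by
  have hcont : Continuous fun z ↦ (F z).re :=
    continuous_re.comp (hF.continuous (continuous_symm_comp_cover e₀))
  obtain ⟨z₀, hz₀⟩ := exists_forall_le_of_latticePeriodic (Φ₀ := Φ₀) hcont fun z n ↦ by
    show (F (z + latticeVec Φ₀ n)).re = (F z).re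
    rw [hF.apply_add_latticeVec, add_re, hF.re_period_eq_zero hre n, add_zero]
  exact hF.eq_zero_of_isMax_re hη hz₀

/-- **`dim_ℂ H⁰(T, Ω¹) ≤ 1` for a Riemann surface homeomorphic to a torus**: any two holomorphic
`1`-forms on `T` are `ℂ`-linearly dependent (developments `Fᵢ` with `Fᵢ 0 = 0`; the `ℝ`-linear map
`(a, b) ↦` real parts of the basic periods of `a F₁ + b F₂` has a kernel vector, `4 > 2`; then
`eq_zero_of_forall_re_period_eq_zero`). [cite: FarkasKra1992, III.2.7] -/
theorem exists_ne_zero_smul_add_smul_eq_zero (e₀ : T ≃ₜ ComplexTorus Φ₀) {η₁ η₂ : MeromorphicOneForm T}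
    (h₁ : η₁.IsHolomorphic) (h₂ : η₂.IsHolomorphic) :
    ∃ c : ℂ × ℂ, c ≠ 0 ∧ c.1 • η₁ + c.2 • η₂ = 0 := by
  set q : ℂ → T := fun z ↦ e₀.symm (cover Φ₀ z) with hq
  have hqc : Continuous q := continuous_symm_comp_cover e₀
  obtain ⟨F₁, hF₁, hF₁0⟩ := exists_isDevelopment h₁ hqc (0 : ℂ)
  obtain ⟨F₂, hF₂, hF₂0⟩ := exists_isDevelopment h₂ hqc (0 : ℂ)
  set v : Fin 2 → ℂ := fun i ↦ latticeVec Φ₀ (Pi.single i 1) with hv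
  -- the ℝ-linear period map
  let L : (ℂ × ℂ) →ₗ[ℝ] (ℝ × ℝ) :=
    { toFun := fun c ↦ ((c.1 * F₁ (v 0) + c.2 * F₂ (v 0)).re, (c.1 * F₁ (v 1) + c.2 * F₂ (v 1)).re)
      map_add' := fun c d ↦ by
        simp only [Prod.fst_add, Prod.snd_add, Prod.mk_add_mk, add_mul, add_re]
        ring_nf
      map_smul' := fun r c ↦ by
        simp only [Prod.smul_fst, Prod.smul_snd, RingHom.id_apply, Prod.smul_mk, smul_eq_mul,
          Complex.real_smul, mul_assoc, ← mul_add, re_ofReal_mul] }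
  have hker : LinearMap.ker L ≠ ⊥ := by
    apply LinearMap.ker_ne_bot_of_finrank_lt
    simp only [Module.finrank_prod, Complex.finrank_real_complex, Module.finrank_self]
    norm_num
  obtain ⟨c, hcker, hc0⟩ : ∃ c ∈ LinearMap.ker L, c ≠ 0 := (Submodule.ne_bot_iff _).1 hker
  refine ⟨c, hc0, ?_⟩
  have hF : (c.1 • η₁ + c.2 • η₂).IsDevelopment q (fun z ↦ c.1 * F₁ z + c.2 * F₂ z) :=
    (hF₁.smul c.1).add (hF₂.smul c.2)
  have hη : (c.1 • η₁ + c.2 • η₂).IsHolomorphic := fun p ↦ ((h₁ p).smul c.1).add ((h₂ p).smul c.2)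
  refine hF.eq_zero_of_forall_re_period_eq_zero hη fun i ↦ ?_
  have hL : L c = 0 := hcker
  rw [hF₁0, hF₂0, mul_zero, mul_zero, add_zero, sub_zero]
  fin_cases i
  · exact congrArg Prod.fst hL
  · exact congrArg Prod.snd hL

end Torus

end MeromorphicOneForm

end RiemannSurface

end Literature.Geometry.Kaehler
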